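import Summits.ResolutionOfSingularities.ResolutionOfSingularities.Theses.RadicialJung
import Summits.ResolutionOfSingularities.ResolutionOfSingularities.Theorems.RadicialJungCleanModelsReduction
import HarnessLib

/-!
# Stub `stub_closedPointsOfPrincipalization` for crux stmt-ResolutionOfSingularities-15917 (`RadicialJung.CleanModels`)

Route `ResolutionOfSingularities/RadicialJung`, crux item `CleanModels`, line `Sketch` (rev 6):
the `L`-free cut at closed points (pure glue).

If every `g₀ ∈ K(W) ∖ K(W)^p` on every regular integral separated finite-type `W/k` admits a
proper birational regular model `π : V → W` on which, at every CLOSED point `v`, some non-trivial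
representative `Σ_{j<p} c_j^p g₀^j` of the `K(W)^p`-line of `g₀` is LOOSELY clean at `𝒪_{V,v}`
(toroidal `u ∏ t_i^{a_i}` with `u` a unit, or a unit residually not a `p`-th power, or
`s - c^p ∈ 𝔪_v ∖ 𝔪_v²`), then every purely inseparable `L/K(W)` of degree `p` admits a proper
birational regular model loosely clean at closed points: at each closed `v` there are `y ∈ L ∖ K(W)`
and `g ∈ K(W)` with `g = y^p` and `π^*g` loosely clean at `v`.

Proof (the first half of `cleanModels_of_logCleanPrincipalization`, without the pointwise
transfer): a generator `y₀ ∈ L ∖ K(W)`, `y₀^p = g₀ ∉ K(W)^p` (`stub_generator`); the loosely clean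
model for `g₀`; at a closed point the representative `Σ c_j^p g₀^j` is `y^p` with
`y = Σ c_j y₀^j ∉ K(W)` (`stub_frobeniusTwist` with `ε = 1`, `δ = 0`).
-/

noncomputable section

set_option linter.dupNamespace false -- mandated namespace of this single-conjunct summit

open CategoryTheory AlgebraicGeometry TopologicalSpace IsLocalRing
open Literature.AlgebraicGeometry.Resolution Literature.AlgebraicGeometry.Motives

namespace Summit.ResolutionOfSingularities.ResolutionOfSingularities.Theorems.RadicialJung.CleanModels

/-- **From `L`-free loose principalization at closed points to the `L`-version.**
If every `g₀ ∈ K(W) ∖ K(W)^p` on every regular integral separated finite-type `W/k` admits a proper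
birational regular model loosely clean at closed points up to the `K(W)^p`-line of `g₀`, then every
purely inseparable `L/K(W)` of degree `p` admits a proper birational regular model loosely clean at
closed points (generator `y₀`, `y₀^p = g₀ ∉ K(W)^p` by `stub_generator`; `Σ c_j^p g₀^j = y^p` with
`y = Σ c_j y₀^j ∉ K(W)` by `stub_frobeniusTwist` with `ε = 1`, `δ = 0`). -/
theorem stub_closedPointsOfPrincipalization
    (h : ∀ (p : ℕ), p.Prime → ∀ (k : Type) [Field k] [CharP k p] (W : Scheme.{0}) [IsIntegral W]
      (f : W ⟶ Spec (.of k)) [IsSeparated f] [LocallyOfFiniteType f] [QuasiCompact f],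
      Scheme.IsRegular W → ∀ g₀ : W.functionField, (∀ c : W.functionField, c ^ p ≠ g₀) →
      ∃ (V : Scheme.{0}) (π : V ⟶ W) (_ : IsIntegral V) (_ : IsDominant π),
        IsProper π ∧ IsBirational π ∧ Scheme.IsRegular V ∧
        ∀ v : V, IsClosed ({v} : Set V) →
          ∃ c : Fin p → W.functionField, (∃ j : Fin p, (j : ℕ) ≠ 0 ∧ c j ≠ 0) ∧
          ((∃ (d m : ℕ) (hmd : m ≤ d) (t : Fin d → V.presheaf.stalk v) (a : Fin m → ℕ)
              (u : V.presheaf.stalk v), IsUnit u ∧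
              Ideal.span (Set.range t) = maximalIdeal (V.presheaf.stalk v) ∧
              ringKrullDim (V.presheaf.stalk v) = (d : WithBot ℕ∞) ∧ 0 < m ∧ (∀ i, ¬ p ∣ a i) ∧
              RatFn.functionFieldMap π (∑ j : Fin p, c j ^ p * g₀ ^ (j : ℕ)) =
                algebraMap (V.presheaf.stalk v) V.functionField
                  (u * ∏ i : Fin m, t (Fin.castLE hmd i) ^ (a i))) ∨
            (∃ u : V.presheaf.stalk v, IsUnit u ∧
              RatFn.functionFieldMap π (∑ j : Fin p, c j ^ p * g₀ ^ (j : ℕ)) =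
                algebraMap (V.presheaf.stalk v) V.functionField u ∧
              ∀ c' : V.presheaf.stalk v, u - c' ^ p ∉ maximalIdeal (V.presheaf.stalk v)) ∨
            (∃ s c' : V.presheaf.stalk v,
              RatFn.functionFieldMap π (∑ j : Fin p, c j ^ p * g₀ ^ (j : ℕ)) =
                algebraMap (V.presheaf.stalk v) V.functionField s ∧
              s - c' ^ p ∈ maximalIdeal (V.presheaf.stalk v) ∧
              s - c' ^ p ∉ maximalIdeal (V.presheaf.stalk v) ^ 2))) :
    ∀ (p : ℕ), p.Prime → ∀ (k : Type) [Field k] [CharP k p] (W : Scheme.{0}) [IsIntegral W]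
      (f : W ⟶ Spec (.of k)) [IsSeparated f] [LocallyOfFiniteType f] [QuasiCompact f],
      Scheme.IsRegular W → ∀ (L : Type) [Field L] [Algebra W.functionField L]
      [IsPurelyInseparable W.functionField L], Module.finrank W.functionField L = p →
      ∃ (V : Scheme.{0}) (π : V ⟶ W) (_ : IsIntegral V) (_ : IsDominant π),
        IsProper π ∧ IsBirational π ∧ Scheme.IsRegular V ∧
        ∀ v : V, IsClosed ({v} : Set V) → ∃ (y : L) (g : W.functionField),
          y ∉ Set.range (algebraMap W.functionField L) ∧ algebraMap W.functionField L g = y ^ p ∧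
          ((∃ (d m : ℕ) (hmd : m ≤ d) (t : Fin d → V.presheaf.stalk v) (a : Fin m → ℕ)
              (u : V.presheaf.stalk v), IsUnit u ∧
              Ideal.span (Set.range t) = maximalIdeal (V.presheaf.stalk v) ∧
              ringKrullDim (V.presheaf.stalk v) = (d : WithBot ℕ∞) ∧ 0 < m ∧ (∀ i, ¬ p ∣ a i) ∧
              RatFn.functionFieldMap π g = algebraMap (V.presheaf.stalk v) V.functionField
                (u * ∏ i : Fin m, t (Fin.castLE hmd i) ^ (a i))) ∨
            (∃ u : V.presheaf.stalk v, IsUnit u ∧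
              RatFn.functionFieldMap π g = algebraMap (V.presheaf.stalk v) V.functionField u ∧
              ∀ c : V.presheaf.stalk v, u - c ^ p ∉ maximalIdeal (V.presheaf.stalk v)) ∨
            (∃ s c : V.presheaf.stalk v,
              RatFn.functionFieldMap π g = algebraMap (V.presheaf.stalk v) V.functionField s ∧
              s - c ^ p ∈ maximalIdeal (V.presheaf.stalk v) ∧
              s - c ^ p ∉ maximalIdeal (V.presheaf.stalk v) ^ 2)) := by
  intro p hp k _ _ W _ f _ _ _ hW L _ _ _ hdeg
  haveI : CharP W.functionField p := charP_stalk W f _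
  -- a generator of `L/K(W)`: `y₀ ∉ K(W)`, `y₀^p = g₀ ∉ K(W)^p`
  obtain ⟨-, y₀, g₀, hy₀, hg₀, hg₀p⟩ :=
    stub_generator (K := W.functionField) (L := L) p hp hdeg
  -- the loosely clean model for `g₀`
  obtain ⟨V, π, hVint, hπdom, hπprop, hπbir, hVreg, hclean⟩ := h p hp k W f hW g₀ hg₀p
  refine ⟨V, π, hVint, hπdom, hπprop, hπbir, hVreg, fun v hv => ?_⟩
  obtain ⟨c, ⟨j₀, hj₀, hc⟩, hloose⟩ := hclean v hv
  -- the representative `Σ c_j^p g₀^j` is the `p`-th power of `Σ c_j y₀^j ∈ L ∖ K(W)`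
  obtain ⟨y, hy, hyp⟩ :=
    stub_frobeniusTwist (K := W.functionField) (L := L) p hp y₀ g₀ hy₀ hg₀ c j₀ hj₀ hc
      1 one_ne_zero 0 (Nat.zero_le 1)
  rw [one_pow, one_mul, Nat.cast_zero, add_zero] at hyp
  exact ⟨y, ∑ j : Fin p, c j ^ p * g₀ ^ (j : ℕ), hy, hyp, hloose⟩

end Summit.ResolutionOfSingularities.ResolutionOfSingularities.Theorems.RadicialJung.CleanModels

end
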